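import Mathlib
import HarnessLib
import HarnessLib.Audit
import Summits.BirchSwinnertonDyer.Statement
import Summits.BirchSwinnertonDyer.BirchSwinnertonDyer.Theorems.Rank1ResidualX9TwistCriterion
import Summits.BirchSwinnertonDyer.Rank1Residual.X9.TwistStability
import Summits.BirchSwinnertonDyer.BirchSwinnertonDyer.Theorems.SignedLowerHalvesRealPeriodUnitPlusPeriod
import Summits.BirchSwinnertonDyer.BirchSwinnertonDyer.Theorems.InputsGreenbergCharValueRankZeroByName
import Summits.BirchSwinnertonDyer.BirchSwinnertonDyer.Theorems.Rank1ResidualX9Defs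
import HarnessLib.Audit.Status.Attr

/-!
Route: TwinTransportX9

# Route TwinTransportX9 — Transport the mu-defect along admissible twists to a trivial rank-0 twin
(X9)

LINE (D-0145 ideator seat bsd-idea-2 g2; bears_on rung K6 = `Rank1Residual.BSDpOnClassX9`, via its
engine `Rank1Residual.IntegralMainConjectureOnClassX9`; no summit is proved by a line, BSD is not
proved). On class X9 the integral cyclotomic main conjecture holds up to a power p^k (BCS 2025 Thm
1.1.2(a)); the integer k = mu(X) - mu(L_p) is the mu-DEFECT of the pair. It suffices to show: (K1)
the defect is ANTI-SYMMETRIC along every BCS-admissible imaginary-quadratic twist, k(E) + k(E^dK) =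
0 (cyclotomic specialisation of the two-variable equality over K; KOLY Prop 5.8.C(ii) typed
standalone), hence CONSERVED along double twists; (K2) every X9 pair with p not dividing the
Tamagawa product has, at most two admissible steps away, a TRIVIAL TWIN: an analytic-rank-0 twist
whose p-part of BSD is visibly trivial on both sides (p prime to #Sha, to the Tamagawa product, to
the torsion, and L(E',1)/Omega a p-unit); (Zero, support) at a trivial twin k = 0 by Greenberg's
Euler-characteristic formula and Mazur-Swinnerton-Dyer interpolation; so k(E) = 0, i.e. the integral
main conjecture at E, with the p | Tamagawa pairs carried as the declared residual (K3). The K6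
kernel `bsdpOnClassX9_of_integralMainConjectureOnClassX9` then gives the leaf with the shared riders
PublishedInputsX9 (stmt-19632) and SchneiderX9RankOne (stmt-19631).
Lean: `TwistDefectBalanceX9 → TrivialTwinSupplyX9 → TwinDefectZeroX9 → TamagawaResidualIMCX9 →
PublishedInputsX9 →
Summit.BirchSwinnertonDyer.BirchSwinnertonDyer.Rank1Residual.IntegralMainConjectureOnClassX9`

## Assembly
Per X9 pair (W,p): if p | W.tamagawaProduct use TamagawaResidualIMCX9. Else take (dK,dF), W1 (and
possibly (dK',dF'), W2) from TrivialTwinSupplyX9; W1, W2 are X9 at p by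
`X9.classX9_of_smul_eq_quadraticTwist` (p does not divide dK since p splits in K); newforms for W1,
W2 from `exists_isNewformOf_of_nonempty_modularParametrizationData`; BCS (a) (first conjunct of
PublishedInputsX9) gives torsion and (g,k) at W and (g1,k1) at W1; TwinDefectZeroX9 gives a
generator with k = 0 at the twin; TwistDefectBalanceX9 once (rank odd) or twice (rank even: k(W) =
-k(W1) = k(W2)) gives k(W) = 0, i.e. iota(g) = L_p(f,alpha): the conclusion of
IntegralMainConjectureOnClassX9 at (W,p). Bookkeeping over existing decls; prover-closable
(difficulty M). The deciding theorem `closes` then applies the K6 kernel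
`Rank1Residual.bsdpOnClassX9_of_integralMainConjectureOnClassX9` with the seven published conjuncts
of PublishedInputsX9 and SchneiderX9RankOne.

CLOSES_TARGET: closes rung K6 of BirchSwinnertonDyer: Summit.BirchSwinnertonDyer.BirchSwinnertonDyer.Rank1Residual.BSDpOnClassX9 (D-0061; not the summit Statement) — the deciding theorem of this route concludes that registered leaf instead of the Statement decl `BirchSwinnertonDyer` (class rung: servable and labelled, never counted as concluding the summit Statement).

Rationale: WHY THIS LINE. Technique card «monotone quantity hunt»: the hunted quantity is the mu-defect k, and
the finding is that it is not monotone but CONSERVED (up to sign) along the BCS-admissible twist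
orbit — BCS25 (arXiv:2405.00270) Thm 1.4.1 / (1.3) give the two-variable main conjecture over an
admissible K WITHOUT (im), and its cyclotomic specialisation (CGS23 Prop 1.2.4-type descent,
SkinnerUrban2014 3.2.11, Greenberg2016 Prop 4.1.1) equates mu(X(E/K^cyc)) = mu(X(E)) + mu(X(E^K))
with mu of L_p(E)L_p(E^K), i.e. k(E) + k(E^K) = 0. A conserved quantity is evaluated where it is
visible: at an analytic-rank-0 twist with trivial p-part, where Greenberg's formula
(greenberg_charValue_rankZero, in tree) and interpolation read k off the classical BSD numbers, k =
v_p(#Sha[p^inf]) - v_p(#Sha_an) = 0. Imported from outside Iwasawa theory: horizontal arithmetic of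
the quadratic-twist family (Kolyvagin under (irr) only = MatarNekovar2019 Thm 0.3, in tree;
p-indivisibility of twisted L-values, Prasanna 2010 doi:10.4153/cjm-2010-023-2; W. Zhang 2014
doi:10.4310/cjm.2014.v2.n2.a2). What it does that the listed routes do not: SmallImageMuTransfer /
PrintX9 need mu = 0 FOR E ITSELF (AnalyticMuZeroX9 19630 + MuTransfer 19629); OneSidedTwistSqueezeX9
needs one-sided Kato divisibility on X9 (20547, no tau in the image); the cell road TwistMuTransfer
needs BCS Cor 5.7.2 mu-transfer plus an analytic mu = 0 of a twist (Prasanna's open problem in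
mu-form). This line asks for NO mu = 0 statement anywhere and NO Euler system with big image: only
conservation of k and the existence of one arithmetically trivial rank-0 curve in the orbit.

RANKED CRUXES. #2 TrivialTwinSupplyX9 (crux) — for every X9 pair (W,p) with p not dividing
W.tamagawaProduct there are a BCS-admissible pair (dK,dF) and a globally minimal model W1 of the
twist W^(dK) such that either W1 is a trivial twin at p (analytic rank 0; p prime to shaOrder,
tamagawaProduct, torsionOrder; leadingLCoeff/realPeriodRat a rational p-unit) or one further
admissible step (dK',dF') from W1 reaches a trivial twin W2 ~ W^(dK dK'). [difficulty: open-problem]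
(why it might fail: Prasanna 2010 p.400: at fixed p no theorem gives even one quadratic twist with
p-adic-unit algebraic L-value; class-wide Sha(W')[p]=0 needs p-indivisible Heegner points, printed
only under (sur) (W. Zhang 2014); the small image may force p | L-alg on the whole admissible
orbit.) [doi:10.4153/cjm-2010-023-2, doi:10.4310/cjm.2014.v2.n2.a2, arXiv:2405.00270,
MatarNekovar2019, OnoSkinner1998]
#3 TwistDefectBalanceX9 (crux) — KOLY Prop 5.8.C(ii) in tree currency: for an X9 pair (W,p), a
BCS-admissible (dK,dF), a globally minimal model W1 of W^(dK), cyclotomic data (kappa,gamma),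
newforms f of W and f1 of W1, and generators g, g1 of the characteristic ideals of the cyclotomic
Selmer duals with iota(g) = p^k L_p(f,alpha) and iota(g1) = p^k1 L_p(f1,alpha1): k + k1 = 0.
[difficulty: L] (why it might fail: the EQUALITY needs the two-variable main conjecture over K to be
integral under (irr) alone (BCS25 Thm 1.4.1 + Cor 4.1.4 read without (sur), cell memo Cor 4.2(b),
unrefereed); a height-one prime (p) of X(E/K_inf) invisible to BDP mu = 0 would leave only an
inequality.) [arXiv:2405.00270, CastellaGrossiSkinner2023, SkinnerUrban2014, Greenberg2016,
BertoliniCastellaKings2021]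
#4 TamagawaResidualIMCX9 (crux) — DECLARED RESIDUAL (imported complement, not attacked by this
line): the integral main conjecture at the X9 pairs with p | W.tamagawaProduct (144 of the 790
census pairs), where Gross-Zagier + BSD force p | [E(K):Z y_K] on the whole admissible orbit so no
trivial twin can exist. [difficulty: open-problem] (why it might fail: it is the K6 engine itself on
the p | Tamagawa sub-family; nothing in print reaches it (no tau for Kato, no twin for transport); a
single such pair with k != 0 contradicts no known theorem.) [arXiv:2405.00270, Greenberg1999LNM1716,
MatarNekovar2019]
#5 SchneiderX9RankOne (crux) — shared rider (= stmt-BirchSwinnertonDyer-19631 of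
SmallImageMuTransfer / OneSidedTwistSqueezeX9, same signature): Schneider non-degeneracy of the
canonical p-adic height on the rank-1 X9 pairs, consumed by the K6 kernel. [difficulty:
open-problem] (why it might fail: Schneider's conjecture is open for non-CM curves; a rank-1 X9 pair
with degenerate cyclotomic p-adic height (p-adic regulator 0) is not excluded by any theorem
(barrier PAdicHeightNondegeneracy).) [Schneider1985, PerrinRiou1993, arXiv:2405.00270]
#9 TwinDefectZeroX9 (support) — at a trivial twin the mu-defect vanishes: for W' globally minimal, p
>= 5 good ordinary irreducible, analytic rank 0 with p prime to shaOrder, tamagawaProduct,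
torsionOrder and L(W',1)/Omega a p-unit, every cyclotomic Selmer dual is torsion with a generator g
of its characteristic ideal satisfying iota(g) = L_p(f,alpha) exactly (Greenberg 1999 Prop 4.1 Euler
characteristic = greenberg_charValue_rankZero, Mazur-Swinnerton-Dyer interpolation,
realPeriodRat_eq_unit_mul_plusPeriod, BCS (a) for the shape iota(g) = p^k L_p; GZK for rank 0 and
finite Sha). [difficulty: M] [Greenberg1999LNM1716, MazurTateTeitelbaum1986, arXiv:2405.00270]
#9 PublishedInputsX9 (support) — shared print bundle of rung K6 (= stmt-BirchSwinnertonDyer-19632,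
same signature): BCS Thm 1.1.2(a), Greenberg 4.1, the period comparison, Schneider 1985, Perrin-Riou
1993, modular parametrisation, entire L-function, Gross-Zagier-Kolyvagin rank <= 1. [difficulty:
provable-now] [arXiv:2405.00270, Greenberg1999LNM1716, Schneider1985, PerrinRiou1993]

TWO-LAYER PLAN. TrivialTwinSupplyX9 <= (S1) horizontal Heegner-index indivisibility on the
admissible orbit of an X9 curve (for infinitely many admissible dK, p does not divide [E^(d)(K'):Z
y] — Kolyvagin-conjecture-type input under (irr) + X9 image, W. Zhang 2014 without (sur)) -> (S2)
unit-twist supply (Ono-Skinner 1998 / Prasanna 2010 shape: a positive proportion of admissible d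
with L-alg(E^d) a p-unit and p prime to Tam, tors) -> TrivialTwinSupplyX9 (MatarNekovar2019 Thm 0.3
turns S1 into Sha[p] = 0). Foreseen re-glue (as PrintX9 rev 1 did): replace the Schneider kernel by
the Schneider-free Heegner-road kernel
`bsdpOnClassX9_of_integralMainConjectureOnClassX9_of_heegnerRoad`, merging TamagawaResidualIMCX9
with that kernel's hTam residual and dropping SchneiderX9RankOne. BC5 first rung (LANDED, T3 by
name; tribunal-w seat bsd-trib-w-ttx9): `Theorems/TwinTransportX9Rung648a1.lean` (p604183, commit
5efe058704f3), theorem `TwinTransportX9Rung.rung_648a1_5` (+ `rung_isInstance_648a1_5 :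
TrivialTwinSupplyX9 -> the same body`) = the TrivialTwinSupplyX9 instance at the
p-does-not-divide-Tam pair (648a1, 5): frame (dK,dF) = (-71,73) BCS-admissible in the kernel, twin
W1 = 648a1^(-71) = [0,0,0,-15123,-5010754] (N = 3266568 > 5000, image 5S4: outside every
verified-BSD_5 regime), first disjunct: r_an(W1) = 0, L(W1,1)/Omega(W1) = 36 (5-unit), 5 does not
divide Tam(W1)*tors(W1) (JSW (eq:tamK) + irreducibility travel with the twist, kernel), Sha(W1)[5] =
0 UNCONDITIONALLY via 5 not dividing [E(K):Z y_K] = 6 over K = Q(sqrt -71) and MatarNekovar2019 Thm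
0.3 + Kolyvagin transported through W1 (x) K = E (x) K (kernel); engine data (r_an, L/Omega, Heegner
index) are DISPLAYED binders certified by ONE hash-first preregistered PARI job (kit j296627 PASS;
memo Cruxes/TrivialTwinSupplyX9/Lines/rung_648a1_5.md). The earlier plan-only stub_twin_608e1_5 was
mis-aimed (608e1 @ 5 is a p | Tam pair, TamagawaTwinSupplyX9's territory, item 24214) and is
superseded by this rung. SECOND RUNG (second image class, vs the key risk "small-image
congruences"): `Theorems/TwinTransportX9Rung9225a1.lean` (p605372, commit f7185f6017e2), theorem
`TwinTransportX9Rung.rung_9225a1_7` (+ `rung_isInstance_9225a1_7`) = the instance at (9225a1, 7) [N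
= 9225 = 3^2 5^2 41, image 7Ns, a_7 = 2, Tam = 2]: frame (-59,181), twin W1 =
[0,0,1,8980980,-112820075899] = minimal model of 9225a1^(-59) (N = 32112225; explicit change of
variables <1,0,0,-1/2> in the kernel), first disjunct: r_an(W1) = 0, L(W1,1)/Omega(W1) = 4 (7-unit),
7 does not divide Tam(W1)*tors(W1) (kernel), Sha(W1)[7] = 0 unconditionally via the Heegner point
y_K = -2g over Q(sqrt -59) (m = 2) and MatarNekovar2019 Thm 0.3 + Kolyvagin (same transport lemma);
ONE hash-first preregistered PARI job kit j298937 PASS C1-C7; memo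
Cruxes/TrivialTwinSupplyX9/Lines/rung_9225a1_7.md. THIRD RUNG (image class 5Ns — the class where
most first admissible frames of slice Ns5A have 5 | m_K, i.e. where the key risk is visible in the
data; one rung per image class {5S4, 7Ns, 5Ns} of the X9 rank-1 certificate cell is now decided):
`Theorems/TwinTransportX9Rung11808a1.lean` (p605742, commit f8e7ff9bc301), theorem
`TwinTransportX9Rung.rung_11808a1_5` (+ `rung_isInstance_11808a1_5`) = the instance at (11808a1 =
[0,0,0,20493,1194858], 5) [N = 11808 = 2^5 3^2 41, a_5 = 1 (anomalous, not excluded by ClassX9 as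
typed), Tam = 2, heegnerCertsNs5A[7]]: frame (-119,73) (2 | N handled by -119 = 1 mod 8 and 73 = 1
mod 8, kernel), twin W1 = [0,0,0,290201373,-2013525712422] = 11808a1^(-119) on the nose (N =
167213088), first disjunct: r_an(W1) = 0, L(W1,1)/Omega(W1) = 4 (5-unit), 5 does not divide
Tam(W1)*tors(W1) (kernel), Sha(W1)[5] = 0 unconditionally via y_K = 2g over Q(sqrt -119) (h = 10, m
= 2) and MatarNekovar2019 Thm 0.3 + Kolyvagin; ONE hash-first preregistered PARI job kit j299102
PASS C1-C7; memo Cruxes/TrivialTwinSupplyX9/Lines/rung_11808a1_5.md. BSD is not proved; nothing is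
claimed for the crux in general.

KILL CRITERIA. Refutation of TwistDefectBalanceX9 at any admissible (W,dK) (e.g. a census pair with
mu(theta_n(E)) + mu(theta_n(E^dK)) provably different from mu_alg(E)+mu_alg(E^dK)) closes the route
(close --reason refuted:TwistDefectBalanceX9). An X9 pair with p prime to Tamagawa whose whole
admissible double-twist orbit has p | L-alg (a congruence obstruction from the small image) refutes
TrivialTwinSupplyX9 and closes the route. Proof of IntegralMainConjectureOnClassX9 elsewhere (K6
engine, OSTS squeeze) moots it; proof of AnalyticMuZeroX9 + MuTransfer supersedes it.

NOT DECOMPOSED YET. The two halves S1/S2 of TrivialTwinSupplyX9 (see Two-layer plan) are not filed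
until the census says which half is the bottleneck; the interpolation/Euler-characteristic
bookkeeping inside TwinDefectZeroX9 (unit (1 - 1/alpha)^2 for non-anomalous twins; anomalous twins
are allowed since the factors cancel between g(0) and L_p(0)) is left to the prover; the p |
Tamagawa residual is deliberately not attacked.

CHEAPEST FALSIFIER. TWIN-CENSUS-v1 (kit job j294940, PARI): for the 24 smallest X9 pairs
(324b1..2888d1 at p = 5, the first p = 7 pairs) enumerate BCS-admissible dK (|dK| <= 1200; double
steps |dK'| <= 160) and test the minimal twist for [analytic rank 0, v_p(Tam) = 0, v_p(tors) = 0,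
v_p(Sha_an) = 0]; a pair with p prime to Tamagawa and NO twin in range is a red flag (then test the
congruence obstruction L-alg(E^d) mod p constant on the orbit); result posted as evidence on
TrivialTwinSupplyX9. Instrument row that would refute the key lemma: X9-MU-TABLE-v1 columns (label,
p, rank, tamagawa, sha_an, tors) extended by (first_twin_d, v_p L-alg(E^d)) — a row with v_p(Tam) =
0 and first_twin = 0 over the full admissible range.

NUMBERS. X9 census (X9-MU-TABLE-v1, 790 pairs, p in {5,7,...}): rank 0: 255 clean / 59 with p | Tam
/ 61 anomalous; rank 1: 272 clean / 85 with p | Tam / 58 anomalous; residual (p | Tam) = 144 pairs;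
smallest pairs 324b1, 324d1, 608b1, 608e1, 648a1 at p = 5 (images 5S4, 5Ns). BCS-admissibility at N
= 324, p = 5 forces dK = 1 mod 24, dK = +-1 mod 5 (first dK = -71).

DEFINITION REQUESTS. None: the twin predicate is inlined (analyticRank, shaOrder, tamagawaProduct,
torsionOrder, leadingLCoeff, realPeriodRat exist); BCSAdmissiblePair, ClassX9, SelmerDualData,
charIdeal, iwasawaToPowerSeries, padicLFunction, unitRoot exist (lean check of Sketch.lean rc 0).

Novelty: Searches (2026-08-28): lit search --hybrid "quadratic twists p-indivisible L-value Heegner point non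
surjective mod p" (8 docs: Cornell-Silverman-Stevens, Tian 1210.8231, Castella-Hsu 2308.10474, Kriz
2021, BCS 2405.00270); lit search --hybrid "horizontal non-vanishing Heegner points modulo p
Burungale Tian" (6: Li-Tian-Yan 2025, Castella 2407.11891, BCS); lit search "Prasanna twists
indivisible p-adic" (remote: Prasanna 2010 doi:10.4153/cjm-2010-023-2, W. Zhang 2014
doi:10.4310/cjm.2014.v2.n2.a2, Burungale-Disegni 1803.09268, BKO 2023); lit galaxy search
"indivisibility of Heegner points|Heegner points modulo p|non-divisibility of Heegner" --star all (2
panama hits: LMS 420 Arithmetic and Geometry; P-adic aspects of modular forms); lit galaxy search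
"quadratic twists|unit L-value" --star pdf (8, none relevant); tree: rg TwistMuTransfer /
KatoDivisibility / MuDefect (cell road and OSTS read in full); ledger negatives --problem
BirchSwinnertonDyer (1 entry, LeadingTerm, unrelated).
Nearest prior art found: the cell's typed road `Rank1ResidualX9TwistCriterion` (TwistMuTransfer =
BCS Cor 5.7.2 mu-transfer E -> E^K, plus TwistedAnalyticMuZeroOnClassX9 = Prasanna's open problem in
mu-form) and KOLY Prop 5.8.C(ii) (cell memo MEMO-es l.28) which states the balance but uses it only
as a consistency check; in print BCS25 Thm 1.4.1/(1.3) and Cor 5.7.2.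
Delta: nobody evaluates the conserved defect at an arithmetically trivial rank-0 member of the
double-twist orbit — this replaces every  [refs: 10.4153/cjm-2010-023-2, 10.4310/cjm.2014.v2.n2.a2, doi:10.4153/cjm-2010-023-2, doi:10.4310/cjm.2014.v2.n2.a2]

Barriers (technique_class: iwasawa-main-conjecture, quadratic-twist, heegner-points): - technique_class: iwasawa-main-conjecture, quadratic-twist, heegner-points
- Literature.Barriers.BirchSwinnertonDyer.EulerSystemBigImageBarrier: evaded — no Kato /
Kolyvagin-system divisibility needing big image is used; the only Euler-system input is Kolyvagin's
bound under (irr) alone (MatarNekovar2019 thm03, in tree) at the analytic-rank-0 twin, and BCS (a) /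
(1.3), printed without (im).
- Literature.Barriers.BirchSwinnertonDyer.PAdicHeightBarrier: it does not, for the rank-1 half of
the K6 kernel: SchneiderX9RankOne is the shared open rider of K6 / OSTS (stmt-19631); the bet is the
foreseen Schneider-free re-glue onto the Heegner-road kernel (PrintX9 rev 1 pattern); the transport
itself (TwistDefectBalanceX9, TrivialTwinSupplyX9, TwinDefectZeroX9) uses no p-adic height and no
comparison ord_T L_p = rank.
- Literature.Barriers.BirchSwinnertonDyer.EisensteinMuBarrier: outside — X9 is residually
irreducible (p >= 5, E[p] irreducible is part of ClassX9) and the line claims NO mu = 0 statement at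
all (k is a difference of mu-invariants, evaluated where both sides are classical).
- Literature.Barriers.BirchSwinnertonDyer.ExceptionalZeroBarrier: outside — ClassX9 has good
ordinary reduction at p, so no split-multiplicative exceptional zero; the twins are twists by dK
with p split in K, again good ordinary at p (X9.TwistStability).
- Literature.Barriers.BirchSwinnertonDyer.ExceptionalZeroBarrierNarrow: outside — same reason:
L_p(E,T) is only used at good ordinary p (unit root al

History (route lifecycle, newest last):
- 2026-08-28T01:10:22Z · rev 3: dropped TwinDefectZeroX9 — drop TwinDefectZeroX9 (stmt-24083): fact-free typing made it unlandable (critic VERDICT #21 price 3 / #22 price 1, director W-67 (a)); superseded by RankZeroBSD (planner-bsd-idea-2-g2-0)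

sub-problem: BirchSwinnertonDyer · status: open · opened planner-bsd-idea-2-g2-0 2026-08-28T00:25:03Z · rev 10 · ledger route-BirchSwinnertonDyer-TwinTransportX9
GENERATED by the gate from the ledger (D-0016/17). Provers cite these decls: `theorem foo : Summit.BirchSwinnertonDyer.BirchSwinnertonDyer.Theses.TwinTransportX9.<Decl> := …` in Summits/BirchSwinnertonDyer/BirchSwinnertonDyer/Theorems/<Name>.lean.
-/

namespace Summit.BirchSwinnertonDyer.BirchSwinnertonDyer.Theses.TwinTransportX9

open scoped BigOperators Topology Manifold Classical MeasureTheory ProbabilityTheory Matrix InnerProductSpace ComplexConjugate ContinuousMap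
open Filter Set Function TopologicalSpace MeasureTheory

attribute [summit_statement] _root_.BirchSwinnertonDyer
attribute [summit_statement] _root_.Summit.BirchSwinnertonDyer.BirchSwinnertonDyer.Rank1Residual.BSDpOnClassX9

open Literature

/-- item stmt-BirchSwinnertonDyer-24080 · crux · rank 2 · open · by planner
why it might fail: Prasanna 2010 p.400: at fixed p no theorem gives even one quadratic twist with p-adic-unit algebraic L-value; class-wide Sha(W')[p]=0 needs p-indivisible Heegner points, printed only under (sur) (W. Zhang 2014); the small image may force p | L-alg on the whole admissible orbit.
sources: doi:10.4153/cjm-2010-023-2, doi:10.4310/cjm.2014.v2.n2.a2, arXiv:2405.00270, MatarNekovar2019, OnoSkinner1998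
[crux] for every X9 pair (W,p) with p not dividing W.tamagawaProduct there are a BCS-admissible pair
(dK,dF) and a globally minimal model W1 of the twist W^(dK) such that either W1 is a trivial twin at
p (analytic rank 0; p prime to shaOrder, tamagawaProduct, torsionOrder; leadingLCoeff/realPeriodRat
a rational p-unit) or one further admissible step (dK',dF') from W1 reaches a trivial twin W2 ~
W^(dK dK'). [difficulty: open-problem] -/
@[route_item "route-BirchSwinnertonDyer-TwinTransportX9", crux]
def TrivialTwinSupplyX9 : Prop :=
  ∀ (W : WeierstrassCurve ℚ) [W.IsElliptic] [W.IsGloballyMinimal] (p : ℕ) [Fact p.Prime], Summit.BirchSwinnertonDyer.BirchSwinnertonDyer.Rank1Residual.ClassX9 W p → ¬ p ∣ W.tamagawaProduct → ∃ dK dF : ℤ, Summit.BirchSwinnertonDyer.BirchSwinnertonDyer.Rank1Residual.BCSAdmissiblePair W p dK dF ∧ ∃ (W₁ : WeierstrassCurve ℚ) (_ : W₁.IsElliptic) (_ : W₁.IsGloballyMinimal), (∃ C : WeierstrassCurve.VariableChange ℚ, C • W₁ = W.quadraticTwist (dK : ℚ)) ∧ ((W₁.analyticRank = 0 ∧ ¬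 p ∣ W₁.shaOrder ∧ ¬ p ∣ W₁.tamagawaProduct ∧ ¬ p ∣ W₁.torsionOrder ∧ ∃ q : ℚ, W₁.leadingLCoeff / (W₁.realPeriodRat : ℂ) = (q : ℂ) ∧ padicValRat p q = 0) ∨ ∃ dK' dF' : ℤ, Summit.BirchSwinnertonDyer.BirchSwinnertonDyer.Rank1Residual.BCSAdmissiblePair W₁ p dK' dF' ∧ ∃ (W₂ : WeierstrassCurve ℚ) (_ : W₂.IsElliptic) (_ : W₂.IsGloballyMinimal), (∃ C : WeierstrassCurve.VariableChange ℚ, C • W₂ = W₁.quadraticTwist (dK' : ℚ)) ∧ (W₂.analyticRank = 0 ∧ ¬ p ∣ W₂.shaOrder ∧ ¬ p ∣ W₂.tamagawaProduct ∧ ¬ p ∣ W₂.torsionOrder ∧ ∃ q : ℚ, W₂.leadingLCoeff / (W₂.realPeriodRat : ℂ) = (q : ℂ) ∧ padicValRat p q = 0))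

/-- item stmt-BirchSwinnertonDyer-24081 · crux · rank 3 · open · by planner
why it might fail: Two-term balance = memo KOLY 5.8.C(ii), proved only under V(E)=∅ (no vexing primes; BCS25 p.5 L71-72, p.11 L62-70, else Rem 1.5.1's unbuilt Euler system). Typed WITHOUT a vexing clause: beyond memo at V(W)≠∅ pairs; at V=∅ beyond print (memo Cor 4.2(b)=BCK21 3.1 under (irr); tree fact adds p∤h_K).
sources: arXiv:2405.00270 p.4 L52-58 (V), p.5 L71-72 + eq.(1.3), p.11 L62-70, Rem 1.5.1 (p.5 L76-90), Thm 1.4.1, Prop 5.2.1, Thm 4.1.3, Cor 4.1.4, BurungaleCastellaKim2021 Thm 3.1 (memo Cor 4.2(b); tree fact carries extra ¬ p ∣ h_K, DOSSIER §41.6), GreenbergSelmerStructure2016 Prop 4.1.1(b) + §4.3 (LEO/CRK discharged in memo 5.8.B), SkinnerUrban2014 Prop 3.2.3, 3.2.8, Cor 3.2.9(ii), Prop 3.2.11, CastellaGrossiSkinner2025 Prop 1.2.4 (L-side), Prop 2.2.1 (Selmer side), pub/bsd-print-x9/DOSSIER.md §46.2-46.4 (lit g18, v22 sha16 91b641618b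d9cc27)
[crux] KOLY Prop 5.8.C(ii) in tree currency: for an X9 pair (W,p), a BCS-admissible (dK,dF), a
globally minimal model W1 of W^(dK), cyclotomic data (kappa,gamma), newforms f of W and f1 of W1,
and generators g, g1 of the characteristic ideals of the cyclotomic Selmer duals with iota(g) = p^k
L_p(f,alpha) and iota(g1) = p^k1 L_p(f1,alpha1): k + k1 = 0. [difficulty: L] -/
@[route_item "route-BirchSwinnertonDyer-TwinTransportX9", crux]
def TwistDefectBalanceX9 : Prop :=
  ∀ (W : WeierstrassCurve ℚ) [W.IsElliptic] [W.IsGloballyMinimal] (p : ℕ) [Fact p.Prime] (dK dF : ℤ), Summit.BirchSwinnertonDyer.BirchSwinnertonDyer.Rank1Residual.ClassX9 W p → Summit.BirchSwinnertonDyer.BirchSwinnertonDyer.Rank1Residual.BCSAdmissiblePair W p dK dF → ∀ (W₁ : WeierstrassCurve ℚ) [W₁.IsElliptic] [W₁.IsGloballyMinimal], (∃ C : WeierstrassCurve.VariableChange ℚ, C • W₁ = W.quadraticTwist (dK : ℚ)) → ∀ (κ : Literature.NumberTheory.EllipticCurves.ZpExtension ℚ p) (γ : Field.absoluteGaloisGroup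 ℚ) {N : ℕ} [NeZero N] (f : CuspForm (CongruenceSubgroup.Gamma0 N) 2) {N₁ : ℕ} [NeZero N₁] (f₁ : CuspForm (CongruenceSubgroup.Gamma0 N₁) 2), κ.IsCyclotomic → κ.IsTopGenerator γ → Literature.NumberTheory.EllipticCurves.IsCyclotomicVariable p γ → Literature.NumberTheory.EllipticCurves.ModularForms.IsNewformOf W f → Literature.NumberTheory.EllipticCurves.ModularForms.IsNewformOf W₁ f₁ → ∀ (D : W.SelmerDualData κ γ) (D₁ : W₁.SelmerDualData κ γ) (g g₁ : Literature.NumberTheory.EllipticCurves.IwasawaAlgebra p) (k k₁ : ℤ), D.charIdeal = Ideal.span {g} → Literature.NumberTheory.EllipticCurves.iwasawaToPowerSeries p g = PowerSeries.C ((p : ℚ_[p]) ^ k) * Literature.NumberTheory.EllipticCurves.padicLFunction f (Literature.NumberTheory.EllipticCurves.unitRoot W p : ℚ_[p]) → D₁.charIdeal = Ideal.span {g₁} → Literature.NumberTheory.EllipticCurves.iwasawaToPowerSeries p g₁ = PowerSeries.C ((p : ℚ_[p]) ^ k₁) * Literature.NumberTheory.EllipticCurves.padicLFunction f₁ (Literature.NumberTheory.EllipticCurves.unitRoot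 W₁ p : ℚ_[p]) → k + k₁ = 0

/-- item stmt-BirchSwinnertonDyer-24082 · crux · rank 4 · open · by planner
why it might fail: it is the K6 engine itself on the p | Tamagawa sub-family; nothing in print reaches it (no tau for Kato, no twin for transport); a single such pair with k != 0 contradicts no known theorem.
sources: arXiv:2405.00270, Greenberg1999LNM1716, MatarNekovar2019
[crux] DECLARED RESIDUAL (imported complement, not attacked by this line): the integral main
conjecture at the X9 pairs with p | W.tamagawaProduct (144 of the 790 census pairs), where
Gross-Zagier + BSD force p | [E(K):Z y_K] on the whole admissible orbit so no trivial twin can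
exist. [difficulty: open-problem] -/
@[route_item "route-BirchSwinnertonDyer-TwinTransportX9"]
def TamagawaResidualIMCX9 : Prop :=
  ∀ (W : WeierstrassCurve ℚ) [W.IsElliptic] [W.IsGloballyMinimal] (p : ℕ) [Fact p.Prime] (κ : Literature.NumberTheory.EllipticCurves.ZpExtension ℚ p) (γ : Field.absoluteGaloisGroup ℚ) {N : ℕ} [NeZero N] (f : CuspForm (CongruenceSubgroup.Gamma0 N) 2), Summit.BirchSwinnertonDyer.BirchSwinnertonDyer.Rank1Residual.ClassX9 W p → p ∣ W.tamagawaProduct → κ.IsCyclotomic → κ.IsTopGenerator γ → Literature.NumberTheory.EllipticCurves.IsCyclotomicVariable p γ → Literature.NumberTheory.EllipticCurves.ModularForms.IsNewformOf W f → ∀ D : W.SelmerDualData κ γ, D.IsTorsion ∧ ∃ g : Literature.NumberTheory.EllipticCurves.IwasawaAlgebra p, D.charIdeal = Ideal.span {g} ∧ Literature.NumberTheory.EllipticCurves.iwasawaToPowerSeries p g = Literature.NumberTheory.EllipticCurves.padicLFunction f (Literature.NumberTheory.EllipticCurves.unitRoot W p : ℚ_[p])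

/-- item stmt-BirchSwinnertonDyer-19631 · crux · rank 5 · open · by planner
why it might fail: Schneider's conjecture is open for non-CM curves; a rank-1 X9 pair with degenerate cyclotomic p-adic height (p-adic regulator 0) is not excluded by any theorem (barrier PAdicHeightNondegeneracy).
sources: Schneider1985, PerrinRiou1993, arXiv:2405.00270
[crux] Schneider's conjecture on the rank-1 part of X9: for every X9 pair (E, p) of analytic rank 1
and every CANONICAL p-adic height datum Dh on E at p, the cyclotomic p-adic height pairing is
non-degenerate (Reg_p ≠ 0) — the binder hC3 of the kernel bridge; by Perrin-Riou's p-adic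
Gross–Zagier it is equivalent to ord_T L_p(f, α, T) = 1 on these pairs. [difficulty: L] -/
@[route_item "route-BirchSwinnertonDyer-TwinTransportX9", crux]
def SchneiderX9RankOne : Prop :=
  ∀ (W : WeierstrassCurve ℚ) [W.IsElliptic] [W.IsGloballyMinimal] (p : ℕ) [Fact p.Prime], Summit.BirchSwinnertonDyer.BirchSwinnertonDyer.Rank1Residual.ClassX9 W p → W.analyticRank = 1 → ∀ Dh : WeierstrassCurve.PAdicHeightData W p, Dh.IsCanonical → WeierstrassCurve.SchneiderConjecture Dh

/-- item stmt-BirchSwinnertonDyer-24214 · crux · rank 6 · open · by planner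
why it might fail: Class-wide proof needs Sha(E2)[p]=0 at a rank-0 twist with p | Tam(E2): the Kolyvagin-GZ index is then forced divisible by p and Jetchev's Tamagawa-sharpened bound (Thm 1.4) assumes surjective rho-bar; >=2 split primes with p | c_ell escape even that; a congruence may force p | Sha_an orbit-wide.
sources: arXiv:math/0703431 (Jetchev 2008, doi:10.1112/s0010437x08003497) Thm 1.4, Cor 1.5, Hypothesis (*), GreenbergLNM1716 Thm 4.1, arXiv:2405.00270 Thm 1.1.2(a), MatarNekovar2019 thm03 (Literature/.../MatarNekovar2019/ShaIndexBoundIrreducible.lean), Summits/BirchSwinnertonDyer/Rank1Residual/X9/ChaDescentRoute.lean (Cha on X9), kit:j294940 TWIN-CENSUS-v1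
[crux · LINE 4 = 'Tamagawa twin' sub-route of TwinTransportX9 (bsd-idea-2 g2 #2) · bears_on rung K6
(Rank1Residual.BSDpOnClassX9 via the engine IntegralMainConjectureOnClassX9); attacks this route's
declared residual TamagawaResidualIMCX9] Every X9 pair (E,p) with p | Tam(E) has, within at most two
BCS-admissible imaginary-quadratic twist steps, a TAMAGAWA TWIN: a globally minimal model E2 of the
twist with analytic rank 0, p not dividing #Sha(E2) nor #E2(Q)_tors, and v_p(L(E2,1)/Omega_E2) =
v_p(Tam(E2)). WHY THIS LINE: on X9 the mod-p image has order prime to p (normaliser-of-Cartan / S4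
type), so rho-bar is unramified at every multiplicative prime and p | c_ell exactly at the split
multiplicative primes; an admissible dK is a local square at every bad prime, hence v_p(Tam) is
constant on the admissible orbit (instrument TWIN-CENSUS-v1, kit j294940: 9225e1@7 and 9225l1@7 have
v_7(Tam)=1 on the whole orbit) - the residual cannot be twisted away, but it CANCELS: at analytic
rank 0 Greenberg's Thm 4.1 and the Mazur-Tate-Teitelbaum interpolation carry the same p-part of
Tam(E2)*#E2~(F_p)^2 on both sides, so the BCS defect is k(E2) = v_p #Sha(E2) - v_p #Sha_an(E2) and
the twin conditio -/
@[route_item "route-BirchSwinnertonDyer-TwinTransportX9", crux (experiment := "instrument: kit jobs cited as sources kit:j294940 TWIN-CENSUS-v1") (source := "ledger wanted_by.sources on stmt-BirchSwinnertonDyer-24214, 2026-09-01")]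
def TamagawaTwinSupplyX9 : Prop :=
  ∀ (W : WeierstrassCurve ℚ) [W.IsElliptic] [W.IsGloballyMinimal] (p : ℕ) [Fact p.Prime], Summit.BirchSwinnertonDyer.BirchSwinnertonDyer.Rank1Residual.ClassX9 W p → p ∣ W.tamagawaProduct → ∃ dK dF : ℤ, Summit.BirchSwinnertonDyer.BirchSwinnertonDyer.Rank1Residual.BCSAdmissiblePair W p dK dF ∧ ∃ (W₁ : WeierstrassCurve ℚ) (_ : W₁.IsElliptic) (_ : W₁.IsGloballyMinimal), (∃ C : WeierstrassCurve.VariableChange ℚ, C • W₁ = W.quadraticTwist (dK : ℚ)) ∧ ((W₁.analyticRank = 0 ∧ ¬ p ∣ W₁.shaOrder ∧ ¬ p ∣ W₁.torsionOrder ∧ ∃ q : ℚ, W₁.leadingLCoeff / (W₁.realPeriodRat : ℂ) = (q : ℂ) ∧ padicValRat p q = (padicValNat p W₁.tamagawaProduct : ℤ)) ∨ ∃ dK' dF' : ℤ, Summit.BirchSwinnertonDyer.BirchSwinnertonDyer.Rank1Residual.BCSAdmissiblePair W₁ p dK' dF' ∧ ∃ (W₂ : WeierstrassCurve ℚ) (_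 : W₂.IsElliptic) (_ : W₂.IsGloballyMinimal), (∃ C : WeierstrassCurve.VariableChange ℚ, C • W₂ = W₁.quadraticTwist (dK' : ℚ)) ∧ (W₂.analyticRank = 0 ∧ ¬ p ∣ W₂.shaOrder ∧ ¬ p ∣ W₂.torsionOrder ∧ ∃ q : ℚ, W₂.leadingLCoeff / (W₂.realPeriodRat : ℂ) = (q : ℂ) ∧ padicValRat p q = (padicValNat p W₂.tamagawaProduct : ℤ)))

/-- item stmt-BirchSwinnertonDyer-19266 · aside · rank 9 · open · by planner
sources: BCDTJAMS2001 Thm A, Summits/BirchSwinnertonDyer/BirchSwinnertonDyer/Theses/SmallImageMuTransfer.lean (stmt-19266)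
[support] modularity of E/ℚ as parametrisation data (Breuil–Conrad–Diamond–Taylor 2001 Thm A), BY
NAME — conjunct of OrdPublishedInputsAtTwo (19149; Literature.Uncategorized.OrdPublishedInputsAtTwo
l.26); same content, filed so the head constant is item-stated (#15c one rule; cite_only dep) -/
@[route_item "route-BirchSwinnertonDyer-TwinTransportX9"]
def ModularParametrizationSupply : Prop :=
  Literature.NumberTheory.EllipticCurves.ModularForms.nonempty_modularParametrizationData

/-- item stmt-BirchSwinnertonDyer-19273 · aside · rank 9 · open · by planner
sources: BCDTJAMS2001, Wiles1995, Summits/BirchSwinnertonDyer/BirchSwinnertonDyer/Theses/SmallImageMuTransfer.lean (stmt-19273)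
[support] entire continuation of L(E/ℚ, s) (modularity: Breuil–Conrad–Diamond–Taylor 2001 Thm A +
Hecke/Shimura), BY NAME — conjunct of MultConversePublishedInputsAtTwo (19185); same content, filed
so the head constant is item-stated (#15c one rule; cite_only dep) -/
@[route_item "route-BirchSwinnertonDyer-TwinTransportX9"]
def EntireLFunctionRat : Prop :=
  WeierstrassCurve.hasEntireLFunction_rat

/-- item stmt-BirchSwinnertonDyer-19290 · aside · rank 9 · closed · proved by Summit.BirchSwinnertonDyer.BirchSwinnertonDyer.Theorems.SignedLowerHalves.RealPeriodUnitPlusPeriod_proof (prover) · by operator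
sources: GreenbergVatsal2000 Rem 3.4, AbbesUllmo1996 Thm A, Summits/BirchSwinnertonDyer/BirchSwinnertonDyer/Theses/SmallImageMuTransfer.lean (stmt-19290)
[support] Néron period vs. plus period of the newform: Ω_E = u · Ω⁺_f with u a p-adic unit, p ≥ 5
(Manin constant: Mazur 1978 Cor. 4.1, Edixhoven 1991 Prop. 2, Abbes–Ullmo 1996 Thm. A;
Greenberg–Vatsal 2000 Rem. 3.4) — conjunct of PublishedSignedInputs
(stmt-BirchSwinnertonDyer-19005), BY NAME; same content, filed as a split child so the head constant
is item-stated (gate5 #15c one rule; readiness rule 2026-08-15: cite_only dep declared by the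
route); no statement / closes / tribunal change -/
@[route_item "route-BirchSwinnertonDyer-TwinTransportX9"]
def RealPeriodUnitPlusPeriod : Prop :=
  Literature.NumberTheory.EllipticCurves.realPeriodRat_eq_unit_mul_plusPeriod

/-- `RealPeriodUnitPlusPeriod` holds: proved by `Summit.BirchSwinnertonDyer.BirchSwinnertonDyer.Theorems.SignedLowerHalves.RealPeriodUnitPlusPeriod_proof`. -/
theorem RealPeriodUnitPlusPeriod_holds : RealPeriodUnitPlusPeriod := _root_.Summit.BirchSwinnertonDyer.BirchSwinnertonDyer.Theorems.SignedLowerHalves.RealPeriodUnitPlusPeriod_proof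

/-- item stmt-BirchSwinnertonDyer-19459 · aside · rank 9 · open · by planner
sources: arXiv:2405.00270 Thm 1.1.2(a), Summits/BirchSwinnertonDyer/BirchSwinnertonDyer/Theses/SmallImageMuTransfer.lean (stmt-19459)
[support, cite-only] Burungale–Castella–Skinner 2025 Thm 1.1.2 (a) (arXiv:2405.00270v2 p. 2): for
E/ℚ, p ≥ 5 good ordinary with E[p] irreducible, the cyclotomic characteristic ideal equals (L_p(E))
in Λ ⊗ ℚ_p (integrally given μ = 0 on both sides) — conjunct of PublishedInputsX9
(stmt-BirchSwinnertonDyer-19632, text FROZEN REF v8-3), BY NAME; same content, filed as a split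
child so the head constant is item-stated (readiness rule 2026-08-15 / gate5 #15c: a cite_only dep
must be declared by the route); no crux statement / closes / tribunal change; never staffed for
proof (cite-only, to be HELD), closes only when the named fact becomes a theorem -/
@[route_item "route-BirchSwinnertonDyer-TwinTransportX9"]
def BCSCharIdealEqPadicLFunction : Prop :=
  Literature.NumberTheory.EllipticCurves.burungale_castella_skinner_charIdeal_eq_padicLFunction

/-- item stmt-BirchSwinnertonDyer-19460 · aside · rank 9 · closed · proved by Summit.BirchSwinnertonDyer.BirchSwinnertonDyer.Theorems.InputsDeskTwoTurnkey.smallImageMuTransfer_greenbergCharValueRankZero (prover) · by planner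
sources: GreenbergLNM1716 Thm 4.1, Summits/BirchSwinnertonDyer/BirchSwinnertonDyer/Theses/SmallImageMuTransfer.lean (stmt-19460)
[support, cite-only] Greenberg LNM 1716 Thm 4.1 (p. 102; held copy
book:coatesnd-arithmetic-theory-elliptic-curves chunk p0091): the rank-0 Euler-characteristic
formula f_E(0) ~ #Sel · ∏c_v · #Ẽ(𝔽_p)² / #E(ℚ)_tors² at good ordinary p — conjunct of
PublishedInputsX9 (stmt-BirchSwinnertonDyer-19632, text FROZEN REF v8-3), BY NAME; same content,
filed as a split child so the head constant is item-stated (readiness rule 2026-08-15 / gate5 #15c: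
a cite_only dep must be declared by the route); no crux statement / closes / tribunal change; never
staffed for proof (cite-only, to be HELD), closes only when the named fact becomes a theorem -/
@[route_item "route-BirchSwinnertonDyer-TwinTransportX9"]
def GreenbergCharValueRankZero : Prop :=
  Literature.NumberTheory.EllipticCurves.greenberg_charValue_rankZero

/-- `GreenbergCharValueRankZero` holds: proved by `Summit.BirchSwinnertonDyer.BirchSwinnertonDyer.Theorems.InputsDeskTwoTurnkey.smallImageMuTransfer_greenbergCharValueRankZero`. -/
theorem GreenbergCharValueRankZero_holds : GreenbergCharValueRankZero := _root_.Summit.BirchSwinnertonDyer.BirchSwinnertonDyer.Theorems.InputsDeskTwoTurnkey.smallImageMuTransfer_greenbergCharValueRankZero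

/-- item stmt-BirchSwinnertonDyer-19468 · aside · rank 9 · open · by planner
sources: Schneider1985 Thm 2', BalakrishnanMullerStein2015 Thm 1.7, Summits/BirchSwinnertonDyer/BirchSwinnertonDyer/Theses/SmallImageMuTransfer.lean (SchneiderOrderCharGenerator)
[aside] Schneider 1985 Thm 2′ (p. 342) / Thm 7 (p. 371) with Perrin-Riou 1992 §3.4.2–3.4.3
(transcribed from Balakrishnan–Müller–Stein 2015 Thm 1.7): ord_T of a characteristic generator =
rank and its leading term up to a unit, given Schneider's non-degeneracy — conjunct 4 of
PublishedInputsX9, inside the split child IwasawaLeadingTermFactsX9; item-stated BY NAME here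
because split.k_max = 7 from this seat forced two facts into one child. Banked context (aside):
never staffed; no crux statement / closes / tribunal change. -/
@[route_item "route-BirchSwinnertonDyer-TwinTransportX9"]
def SchneiderOrderCharGenerator : Prop :=
  Literature.NumberTheory.EllipticCurves.Schneider1985_order_charGenerator

/-- item stmt-BirchSwinnertonDyer-19469 · aside · rank 9 · open · by planner
sources: PerrinRiou1987 Thm 1.3, Cor 1.8, Summits/BirchSwinnertonDyer/BirchSwinnertonDyer/Theses/SmallImageMuTransfer.lean (stmt-19469)
[aside] Perrin-Riou 1987 Thm 1.3, (1.1) and §1.4 Cor. 1.8 (p-adic Gross–Zagier): rank-one leading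
terms — conjunct 5 of PublishedInputsX9, inside the split child IwasawaLeadingTermFactsX9;
item-stated BY NAME here because split.k_max = 7 from this seat forced two facts into one child.
Banked context (aside): never staffed; no crux statement / closes / tribunal change. -/
@[route_item "route-BirchSwinnertonDyer-TwinTransportX9"]
def PerrinRiouRankOneLeadingTerms : Prop :=
  Literature.NumberTheory.EllipticCurves.perrinRiou_rankOne_leadingTerms

/-- item stmt-BirchSwinnertonDyer-19632 · support · rank 9 · open · by planner
sources: arXiv:2405.00270, Greenberg1999LNM1716, Schneider1985, PerrinRiou1993
[support] The eight PUBLISHED named facts the kernel bridge `bsdpOnClassX9_of_katoMuTransfer`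
consumes, as one conjunction of the tree's cited Props: BCS 2025 Thm 1.1.2 (a) (characteristic ideal
= (L_p) given μ = 0 and Kato), Greenberg 1999 Thm 4.1 (rank-0 Euler characteristic), the real period
vs plus period unit relation, Schneider 1985 (order of the characteristic power series), Perrin-Riou
1987 rank-one leading terms, modularity (parametrisation), entire L-function over ℚ, rank = analytic
rank ≤ 1 (Gross–Zagier–Kolyvagin). Provable-now means: discharge conjunct by conjunct as the
`_holds` theorems land; the non-`_odd` Schneider/Perrin-Riou facts are the bridge's exact binder
types. [difficulty: provable-now] -/
@[route_item "route-BirchSwinnertonDyer-TwinTransportX9", crux]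
def PublishedInputsX9 : Prop :=
  Literature.NumberTheory.EllipticCurves.burungale_castella_skinner_charIdeal_eq_padicLFunction ∧ Literature.NumberTheory.EllipticCurves.greenberg_charValue_rankZero ∧ Literature.NumberTheory.EllipticCurves.realPeriodRat_eq_unit_mul_plusPeriod ∧ Literature.NumberTheory.EllipticCurves.Schneider1985_order_charGenerator ∧ Literature.NumberTheory.EllipticCurves.perrinRiou_rankOne_leadingTerms ∧ Literature.NumberTheory.EllipticCurves.ModularForms.nonempty_modularParametrizationData ∧ WeierstrassCurve.hasEntireLFunction_rat ∧ Literature.NumberTheory.EllipticCurves.rank_eq_analyticRank_of_analyticRank_le_one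

/-- item stmt-BirchSwinnertonDyer-24083 · crux · rank 9 · open · by planner
sources: Greenberg1999LNM1716, MazurTateTeitelbaum1986, arXiv:2405.00270
[support] at a trivial twin the mu-defect vanishes: for W' globally minimal, p >= 5 good ordinary
irreducible, analytic rank 0 with p prime to shaOrder, tamagawaProduct, torsionOrder and
L(W',1)/Omega a p-unit, every cyclotomic Selmer dual is torsion with a generator g of its
characteristic ideal satisfying iota(g) = L_p(f,alpha) exactly (Greenberg 1999 Prop 4.1 Euler
characteristic = greenberg_charValue_rankZero, Mazur-Swinnerton-Dyer interpolation,
realPeriodRat_eq_unit_mul_plusPeriod, BCS (a) for the shape iota(g) = p^k L_p; GZK for rank 0 and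
finite Sha). [difficulty: M] -/
@[route_item "route-BirchSwinnertonDyer-TwinTransportX9", crux]
def TwinDefectZeroX9 : Prop :=
  PublishedInputsX9 → ∀ (W' : WeierstrassCurve ℚ) [W'.IsElliptic] [W'.IsGloballyMinimal] (p : ℕ) [Fact p.Prime], 5 ≤ p → W'.HasGoodReductionAtPrime p → ¬ (p : ℤ) ∣ W'.frobeniusTrace p → W'.HasIrreducibleModPGaloisRep p → (W'.analyticRank = 0 ∧ ¬ p ∣ W'.shaOrder ∧ ¬ p ∣ W'.tamagawaProduct ∧ ¬ p ∣ W'.torsionOrder ∧ ∃ q : ℚ, W'.leadingLCoeff / (W'.realPeriodRat : ℂ) = (q : ℂ) ∧ padicValRat p q = 0) → ∀ (κ : Literature.NumberTheory.EllipticCurves.ZpExtension ℚ p) (γ : Field.absoluteGaloisGroup ℚ) {N : ℕ} [NeZero N] (f : CuspForm (CongruenceSubgroup.Gamma0 N) 2), κ.IsCyclotomic → κ.IsTopGenerator γ → Literature.NumberTheory.EllipticCurves.IsCyclotomicVariable p γ → Literature.NumberTheory.EllipticCurves.ModularForms.IsNewformOf W' f → ∀ D : W'.SelmerDualData κ γ,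 D.IsTorsion ∧ ∃ g : Literature.NumberTheory.EllipticCurves.IwasawaAlgebra p, D.charIdeal = Ideal.span {g} ∧ Literature.NumberTheory.EllipticCurves.iwasawaToPowerSeries p g = Literature.NumberTheory.EllipticCurves.padicLFunction f (Literature.NumberTheory.EllipticCurves.unitRoot W' p : ℚ_[p])

/-- item stmt-BirchSwinnertonDyer-24084 · crux (kind.auto-crux: conjecture-grade) · rank 1 · closed · proved by Summit.BirchSwinnertonDyer.BirchSwinnertonDyer.Rank1Residual.TwinTransport.twinTransportX9_assembly (prover) · by planner
why it might fail: auto-crux — conjecture-grade statement (statement references the registered conjecture Summit.BirchSwinnertonDyer.BirchSwinnertonDyer.Rank1Residual.IntegralMainConjectureOnClassX9); it is open, so it may simply be false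
sources: arXiv:2405.00270, Greenberg1999LNM1716
[assembly] TwistDefectBalanceX9 -> TrivialTwinSupplyX9 -> TwinDefectZeroX9 -> TamagawaResidualIMCX9
-> PublishedInputsX9 -> IntegralMainConjectureOnClassX9. -/
@[route_item "route-BirchSwinnertonDyer-TwinTransportX9", crux]
def Assembly : Prop :=
  TwistDefectBalanceX9 → TrivialTwinSupplyX9 → TwinDefectZeroX9 → TamagawaResidualIMCX9 → PublishedInputsX9 → Summit.BirchSwinnertonDyer.BirchSwinnertonDyer.Rank1Residual.IntegralMainConjectureOnClassX9

-- `Assembly` holds: proved by `Summit.BirchSwinnertonDyer.BirchSwinnertonDyer.Rank1Residual.TwinTransport.twinTransportX9_assembly` (its module imports this route file, so no `_holds` link can be stated here).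

/-- item stmt-BirchSwinnertonDyer-19921 · aside · rank 9 · open · by operator
sources: GrossZagier1986, KolyvaginEulerSystems1990, Summits/BirchSwinnertonDyer/BirchSwinnertonDyer/Theses/SmallImageMuTransfer.lean (stmt-19921)
[support] The one PUBLISHED input the halves-glue consumes: Gross–Zagier–Kolyvagin, rank = analytic
rank for analytic rank ≤ 1 with Ш finite (tree named fact
rank_eq_analyticRank_of_analyticRank_le_one; used by bsdp_of_missingPPartAt to turn Miller's last
clause into BSD(E,2)). Carried as a displayed PUB hypothesis; never counted as progress. The further
PRINT of the roads to the two halves (Greenberg Thm-4.1 analogues at a multiplicative prime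
thm41Analogue_charValue_rankZero_numberField_anyPrime / …_split_baseChange_anyPrime, modularity) and
the referee-passed MEMO inputs (Kato ⊗ℚ at a multiplicative 2:
X5.O1.KatoMultiplicativeDivisibilityRat W 2, HOME mult/PROOF-MULT.md RC-2; Greenberg–Stevens at 2:
greenberg_stevens W 2, mult/PROOF-GS2.md RC-4) enter the LINES under the halves (bridge
multiplicativeRankZeroAtTwo_of_muRoad, p409679), not this glue. -/
@[route_item "route-BirchSwinnertonDyer-TwinTransportX9"]
def RankEqAnalyticRankLeOne : Prop :=
  Literature.NumberTheory.EllipticCurves.rank_eq_analyticRank_of_analyticRank_le_one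

/-- item stmt-BirchSwinnertonDyer-24215 · support · rank 9 · closed · proved by Summit.BirchSwinnertonDyer.BirchSwinnertonDyer.Rank1Residual.TwinTransport.twinTransportX9_rankZeroBSDpToIMC (planner) · by planner
sources: arXiv:2405.00270 Thm 1.1.2(a), GreenbergLNM1716 Thm 4.1, MazurTateTeitelbaum1986 §I.14, Summits/BirchSwinnertonDyer/Rank1Residual/Partition/CornersGreenbergMu.lean
[support · LINE 4] BCS Thm 1.1.2(a) -> Greenberg Thm 4.1 -> period unit -> modularity
(parametrisation, entire L) -> GZK => for every X9 pair (E',p) of analytic rank 0 with p not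
dividing #Sha(E')*#E'(Q)_tors and v_p(L(E',1)/Omega) = v_p Tam(E'), the cyclotomic IMC holds at
(E',p) (X torsion, char X = (L_p) under the Neron normalisation). Proof sketch: BCS(a) gives char =
p^k * unit * L_p; compare constant terms: v_p g(0) = v_p #Sha + v_p Tam^(p) + 2 v_p #E'~(F_p)
(Greenberg 4.1; torsion p-part trivial by irreducibility), v_p L_p(0) = 2 v_p(1 - 1/alpha) +
v_p(L(1)/Omega) (interpolation + period unit) and v_p(1 - 1/alpha) = v_p #E'~(F_p) since beta - 1 is
a unit; the twin condition makes both sides equal, so k = 0. Subsumes TwinDefectZeroX9 (the case v_p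
Tam = 0) and carries the fact antecedents that item lacks; tree precedent X9.mu_eq_zero_of_bsdp /
X9.bsdp_iff_mu_eq_zero (Partition/CornersGreenbergMu.lean) goes through mu and a unit-coefficient
certificate, this item is certificate-free. Size M. -/
@[route_item "route-BirchSwinnertonDyer-TwinTransportX9", crux]
def RankZeroBSDpToIMCX9 : Prop :=
  Literature.NumberTheory.EllipticCurves.burungale_castella_skinner_charIdeal_eq_padicLFunction → Literature.NumberTheory.EllipticCurves.greenberg_charValue_rankZero → Literature.NumberTheory.EllipticCurves.realPeriodRat_eq_unit_mul_plusPeriod → Literature.NumberTheory.EllipticCurves.ModularForms.nonempty_modularParametrizationData → WeierstrassCurve.hasEntireLFunction_rat → Literature.NumberTheory.EllipticCurves.rank_eq_analyticRank_of_analyticRank_le_one → ∀ (W' : WeierstrassCurve ℚ) [W'.IsElliptic] [W'.IsGloballyMinimal] (p : ℕ) [Fact p.Prime], Summit.BirchSwinnertonDyer.BirchSwinnertonDyer.Rank1Residual.ClassX9 W' p → (W'.analyticRank = 0 ∧ ¬ p ∣ W'.shaOrder ∧ ¬ p ∣ W'.torsionOrder ∧ ∃ q : ℚ, W'.leadingLCoeff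 / (W'.realPeriodRat : ℂ) = (q : ℂ) ∧ padicValRat p q = (padicValNat p W'.tamagawaProduct : ℤ)) → ∀ (κ : Literature.NumberTheory.EllipticCurves.ZpExtension ℚ p) (γ : Field.absoluteGaloisGroup ℚ) {N : ℕ} [NeZero N] (f : CuspForm (CongruenceSubgroup.Gamma0 N) 2), κ.IsCyclotomic → κ.IsTopGenerator γ → Literature.NumberTheory.EllipticCurves.IsCyclotomicVariable p γ → Literature.NumberTheory.EllipticCurves.ModularForms.IsNewformOf W' f → ∀ D : W'.SelmerDualData κ γ, D.IsTorsion ∧ ∃ g : Literature.NumberTheory.EllipticCurves.IwasawaAlgebra p, D.charIdeal = Ideal.span {g} ∧ Literature.NumberTheory.EllipticCurves.iwasawaToPowerSeries p g = Literature.NumberTheory.EllipticCurves.padicLFunction f (Literature.NumberTheory.EllipticCurves.unitRoot W' p : ℚ_[p])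

-- `RankZeroBSDpToIMCX9` holds: proved by `Summit.BirchSwinnertonDyer.BirchSwinnertonDyer.Rank1Residual.TwinTransport.twinTransportX9_rankZeroBSDpToIMC` (its module imports this route file, so no `_holds` link can be stated here).

/-- item stmt-BirchSwinnertonDyer-24216 · support · rank 9 · closed · proved by Summit.BirchSwinnertonDyer.BirchSwinnertonDyer.Rank1Residual.TwinTransport.residualTransportX9_holds (prover) · by planner
sources: arXiv:2405.00270 Thm 1.1.2(a), Summits/BirchSwinnertonDyer/Rank1Residual/X9/TwistStability.lean
[support/glue · LINE 4] TwistDefectBalanceX9 -> TamagawaTwinSupplyX9 -> RankZeroBSDpToIMCX9 ->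
PublishedInputsX9 -> TamagawaResidualIMCX9: for a p | Tam pair take the <=2-step twin chain; the
twists stay in X9 (X9.TwistStability classX9_of_smul_eq_quadraticTwist; p does not divide dK because
p splits in K); newforms from nonempty_modularParametrizationData, BCS(a) data at each curve from
PublishedInputsX9.1; IMC at the twin by RankZeroBSDpToIMCX9 (k2 = 0); k(E) = -k1 = k2 = 0 by two
applications of the balance; conclude the IMC identity at E. Bookkeeping, size M; it makes
TamagawaResidualIMCX9 a DERIVED node of `closes` (no longer a hypothesis). -/
@[route_item "route-BirchSwinnertonDyer-TwinTransportX9", crux]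
def ResidualTransportX9 : Prop :=
  TwistDefectBalanceX9 → TamagawaTwinSupplyX9 → RankZeroBSDpToIMCX9 → PublishedInputsX9 → TamagawaResidualIMCX9

-- `ResidualTransportX9` holds: proved by `Summit.BirchSwinnertonDyer.BirchSwinnertonDyer.Rank1Residual.TwinTransport.residualTransportX9_holds` (its module imports this route file, so no `_holds` link can be stated here).

/-- item stmt-BirchSwinnertonDyer-24305 · banked (kind.auto-crux: conjecture-grade) · rank 9 · closed · proved by Summit.BirchSwinnertonDyer.BirchSwinnertonDyer.Rank1Residual.TwinTransport.twinTransportX9_assemblyViaRankZero (planner) · by planner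
why it might fail: auto-crux — conjecture-grade statement (statement references the registered conjecture Summit.BirchSwinnertonDyer.BirchSwinnertonDyer.Rank1Residual.IntegralMainConjectureOnClassX9); it is open, so it may simply be false
sources: arXiv:2405.00270 Thm 1.1.2(a), Summits/BirchSwinnertonDyer/BirchSwinnertonDyer/Theorems/TwinTransportX9Assembly.lean
[support/glue] TwistDefectBalanceX9 -> TrivialTwinSupplyX9 -> RankZeroBSDpToIMCX9 ->
TamagawaResidualIMCX9 -> PublishedInputsX9 -> IntegralMainConjectureOnClassX9: the Assembly with the
zero-defect step supplied by RankZeroBSDpToIMCX9 (proved, Theorems/TwinTransportX9RankZero.lean)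
instead of the fact-free TwinDefectZeroX9; a trivial twin (p not dividing Tam, v_p(L/Omega) = 0)
satisfies the Tamagawa-normalised twin predicate since padicValNat p Tam = 0. Proof =
Theorems/TwinTransportX9Assembly.lean verbatim with hR0 (facts from PublishedInputsX9). Size S. -/
@[route_item "route-BirchSwinnertonDyer-TwinTransportX9"]
def AssemblyViaRankZero : Prop :=
  TwistDefectBalanceX9 → TrivialTwinSupplyX9 → RankZeroBSDpToIMCX9 → TamagawaResidualIMCX9 → PublishedInputsX9 → Summit.BirchSwinnertonDyer.BirchSwinnertonDyer.Rank1Residual.IntegralMainConjectureOnClassX9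

-- `AssemblyViaRankZero` holds: proved by `Summit.BirchSwinnertonDyer.BirchSwinnertonDyer.Rank1Residual.TwinTransport.twinTransportX9_assemblyViaRankZero` (its module imports this route file, so no `_holds` link can be stated here).

/-! D-0027 §2.1 — DECIDING THEOREM (planner-authored via `route open/edit --closes-file`; by planner-bsd-idea-2-g2-0 2026-08-28T00:42:33Z):
its hypotheses are this route's items and its conclusion the registered leaf `Summit.BirchSwinnertonDyer.BirchSwinnertonDyer.Rank1Residual.BSDpOnClassX9` (rung K6, D-0061) (glue_lint), and it elaborates with this file. -/

@[closes "route-BirchSwinnertonDyer-TwinTransportX9"] theorem closes (hAsm : Assembly) (hBal : TwistDefectBalanceX9) (hTwin : TrivialTwinSupplyX9)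
    (hZero : TwinDefectZeroX9) (hTamTwin : TamagawaTwinSupplyX9) (hR0 : RankZeroBSDpToIMCX9)
    (hRes : ResidualTransportX9) (hPub : PublishedInputsX9) (hSch : SchneiderX9RankOne) :
    Summit.BirchSwinnertonDyer.BirchSwinnertonDyer.Rank1Residual.BSDpOnClassX9 := by
  have hTam : TamagawaResidualIMCX9 := hRes hBal hTamTwin hR0 hPub
  have hIMC : Summit.BirchSwinnertonDyer.BirchSwinnertonDyer.Rank1Residual.IntegralMainConjectureOnClassX9 :=
    hAsm hBal hTwin hZero hTam hPub
  obtain ⟨-, hGr, h5, hS, hPR, hmodP, hmodL, hGZK⟩ := hPub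
  exact Summit.BirchSwinnertonDyer.BirchSwinnertonDyer.Rank1Residual.bsdpOnClassX9_of_integralMainConjectureOnClassX9 hGr h5 hS hPR hmodP hmodL hGZK hIMC hSch

end Summit.BirchSwinnertonDyer.BirchSwinnertonDyer.Theses.TwinTransportX9
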